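import Literature.NumberTheory.GelbartRogawski1991.LocalUnitaryUndoubling
import Literature.RepresentationTheory.HeisenbergGroup.SchrodingerGaloisTwist
import Literature.RepresentationTheory.HeisenbergGroup.SchrodingerAddCharDilation
import HarnessLib

-- buildfix G11b-3 recipe (LEDGER B13-1/B13-3), as in the GelbartRogawski1991 siblings: elaborate sequentially so the
-- trailing `attribute [implicit_reducible]` blocks of the imports are in force (inert for the kernel).
set_option Elab.async false

/-!
# A box-compatible transport identity of DOUBLED Weil operators descends through local undoubling

Topic `NumberTheory/GelbartRogawski1991`; namespace `Literature.NumberTheory.GelbartRogawski1991.UnitaryDualPair.LocalSplitting`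
(that of `LocalUnitaryUndoubling`).  KERNEL ONLY: theorems; no definition, no named fact, no `sorry`.

`LocalUnitaryUndoubling` restricts a homomorphism `s^𝔻 : U(J ⊕ −J)(F_v) →* S̃p(𝕎^𝔻_v)` over `ι^𝔻_v` to `U(J) × 1` and STRIPS the
second variables: `ω(s^𝔻(g ⊕ 1))(f₁ ⊠ f₂) = ω(undoubleLoc s^𝔻 g) f₁ ⊠ f₂` (`toRep_undoubleLoc_boxSB`, [MVW87] Chap. 2 II.1 Rem. (6)).
Here we record the immediate consequence used by the Galois-twist road of the cell `hodgecm-mathlib` ([Liu2021] Thm. 4.18 (3),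
piece III-11a): an identity between the DOUBLED operators of two packages `(T₀, s₀^𝔻)`, `(T₁, s₁^𝔻)` through a map `BD` of
`𝒮(F_v^{n+n})` which is BOX-COMPATIBLE with a map `B` of `𝒮(F_vⁿ)` on one test vector (`BD (f₁ ⊠ f₂) = B f₁ ⊠ f₂'`, `f₂' ≠ 0`) —

  `BD (ω^𝔻₀(s₀^𝔻(g ⊕ 1)) (f₁ ⊠ f₂)) = ω^𝔻₁(s₁^𝔻(g' ⊕ 1)) (BD (f₁ ⊠ f₂))`   for all `f₁`

— DESCENDS to the undoubled operators: `B (ω₀(undoubleLoc s₀^𝔻 g) f₁) = ω₁(undoubleLoc s₁^𝔻 g') (B f₁)`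
(`apply_toRep_undoubleLoc_eq_of_box_transport`, by `⊠ f₂'`-cancellation).  The two transports of the road are box-compatible
on the nose: the Galois twist `f ↦ τ ∘ f` (`schwartzGalConj_boxSB`: `τ` is multiplicative) and the dilation `D_s`
(`leviEquivSB_smulOfUnit_boxSB`: `s⁻¹ • (a ⊔ b) = (s⁻¹ • a) ⊔ (s⁻¹ • b)`), hence so is their composite (`galDilation_boxSB`).  So the
DOUBLED section identity of `LocalSplittingCMGaloisTransportRigidity` (Kudla rigidity, read at operators) yields the UNDOUBLED transport
identity `hT` consumed by `Def411WeilCarriersGaloisTwistOmega.exists_semilinear_quot_of_galTwist_transport`.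
HC_CM is proved only modulo the 7 printed citations until rung 0 of the ladder closes; nothing about it is claimed here.

## References
* [MoeglinVignerasWaldspurger1987] C. Mœglin, M.-F. Vignéras, J.-L. Waldspurger, LNM 1291 (1987), Chap. 2 II.1 (transport of
  structure) and Rem. (6) (restriction to `Sp(W₁) × Sp(W₂)` of the metaplectic representation of `W₁ ⊕ W₂`).
* [GelbartRogawski1991] S. Gelbart, J. Rogawski, Invent. Math. 105 (1991), §3.1 Prop. 3.1.1 p. 455 (splitting by doubling).
* [Liu2021] Y. Liu, Camb. J. Math. 9 (2021), Thm. 4.18 (3), proof l. 2272–2289 (the consumer).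
-/

set_option autoImplicit false

noncomputable section

open NumberField IsDedekindDomain Matrix
open Literature.RepresentationTheory.HeisenbergGroup
open Literature.NumberTheory.Automorphic Literature.NumberTheory.Weil1964

/-! ## §1 Box-compatibility of the Galois twist and of the dilation -/

namespace Literature.RepresentationTheory.HeisenbergGroup

section Box

variable (K : Type*) [Field K] [ValuativeRel K] [TopologicalSpace K] [IsNonarchimedeanLocalField K] {ι₁ ι₂ ι : Type*}
  [Fintype ι₁] [Fintype ι₂] [Fintype ι] (e : ι₁ ⊕ ι₂ ≃ ι)

/-- **the Galois twist is multiplicative on products**: `τ ∘ (f₁ ⊠ f₂) = (τ ∘ f₁) ⊠ (τ ∘ f₂)`.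
[cite: MoeglinVignerasWaldspurger1987, Chap. 2 II.1 (transport of structure) and Rem. (6)] -/
theorem schwartzGalConj_boxSB (τ : ℂ →+* ℂ) (f₁ : SchwartzBruhat (ι₁ → K)) (f₂ : SchwartzBruhat (ι₂ → K)) :
    schwartzGalConj τ (boxSB K e f₁ f₂) = boxSB K e (schwartzGalConj τ f₁) (schwartzGalConj τ f₂) := by
  apply Subtype.ext
  funext u
  rw [coe_schwartzGalConj, coe_boxSB, coe_boxSB, Function.comp_apply, map_mul, coe_schwartzGalConj, coe_schwartzGalConj]
  rfl

omit [Field K] [ValuativeRel K] [TopologicalSpace K] [IsNonarchimedeanLocalField K] [Fintype ι₁] [Fintype ι₂] [Fintype ι] in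
/-- coordinates of a dilated vector: `(c • u)|ι₁ = c • u|ι₁`, `(c • u)|ι₂ = c • u|ι₂`. [folklore] -/
private theorem resL_smul_resR_smul {R : Type*} [SMul R K] (c : R) (u : ι → K) :
    resL e (c • u) = c • resL e u ∧ resR e (c • u) = c • resR e u :=
  ⟨funext fun _ => rfl, funext fun _ => rfl⟩

/-- **the dilation is coordinatewise on products**: `D_s (f₁ ⊠ f₂) = D_s f₁ ⊠ D_s f₂` (`(D_s f)(u) = f(s⁻¹ u)` and
`(s⁻¹ u)|ιⱼ = s⁻¹ (u|ιⱼ)`). [cite: Weil1964, n° 13, p. 160] [cite: MoeglinVignerasWaldspurger1987, Chap. 2 II.1 Rem. (6)] -/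
theorem leviEquivSB_smulOfUnit_boxSB (s : Kˣ) (f₁ : SchwartzBruhat (ι₁ → K)) (f₂ : SchwartzBruhat (ι₂ → K)) :
    leviEquivSB (LinearEquiv.smulOfUnit s : (ι → K) ≃ₗ[K] (ι → K)) (continuous_const_smul (s : K))
        (continuous_const_smul ((s⁻¹ : Kˣ) : K)) (boxSB K e f₁ f₂) =
      boxSB K e
        (leviEquivSB (LinearEquiv.smulOfUnit s : (ι₁ → K) ≃ₗ[K] (ι₁ → K)) (continuous_const_smul (s : K))
          (continuous_const_smul ((s⁻¹ : Kˣ) : K)) f₁)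
        (leviEquivSB (LinearEquiv.smulOfUnit s : (ι₂ → K) ≃ₗ[K] (ι₂ → K)) (continuous_const_smul (s : K))
          (continuous_const_smul ((s⁻¹ : Kˣ) : K)) f₂) := by
  apply Subtype.ext
  funext u
  rw [coe_leviEquivSB_smulOfUnit_apply, coe_boxSB, coe_boxSB]
  dsimp only
  rw [coe_leviEquivSB_smulOfUnit_apply, coe_leviEquivSB_smulOfUnit_apply, (resL_smul_resR_smul K e _ u).1,
    (resL_smul_resR_smul K e _ u).2]

/-- **the composite transport `B = D_s ∘ (τ ∘ ·)` of the Galois-twist road is box-compatible**: `B(f₁ ⊠ f₂) = B f₁ ⊠ B f₂`.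
[cite: MoeglinVignerasWaldspurger1987, Chap. 2 II.1 (transport of structure) and Rem. (6)] -/
theorem galDilation_boxSB (τ : ℂ →+* ℂ) (s : Kˣ) (f₁ : SchwartzBruhat (ι₁ → K)) (f₂ : SchwartzBruhat (ι₂ → K)) :
    leviEquivSB (LinearEquiv.smulOfUnit s : (ι → K) ≃ₗ[K] (ι → K)) (continuous_const_smul (s : K))
        (continuous_const_smul ((s⁻¹ : Kˣ) : K)) (schwartzGalConj τ (boxSB K e f₁ f₂)) =
      boxSB K e
        (leviEquivSB (LinearEquiv.smulOfUnit s : (ι₁ → K) ≃ₗ[K] (ι₁ → K)) (continuous_const_smul (s : K))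
          (continuous_const_smul ((s⁻¹ : Kˣ) : K)) (schwartzGalConj τ f₁))
        (leviEquivSB (LinearEquiv.smulOfUnit s : (ι₂ → K) ≃ₗ[K] (ι₂ → K)) (continuous_const_smul (s : K))
          (continuous_const_smul ((s⁻¹ : Kˣ) : K)) (schwartzGalConj τ f₂)) := by
  rw [schwartzGalConj_boxSB, leviEquivSB_smulOfUnit_boxSB]

omit [Fintype ι] in
/-- the composite transport kills no non-zero vector (`τ` injective, `D_s` bijective): `B f ≠ 0` for `f ≠ 0`.
[cite: MoeglinVignerasWaldspurger1987, Chap. 2 II.1 (transport of structure)] -/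
theorem galDilation_ne_zero (τ : ℂ →+* ℂ) (s : Kˣ) {f : SchwartzBruhat (ι → K)} (hf : f ≠ 0) :
    leviEquivSB (LinearEquiv.smulOfUnit s : (ι → K) ≃ₗ[K] (ι → K)) (continuous_const_smul (s : K))
        (continuous_const_smul ((s⁻¹ : Kˣ) : K)) (schwartzGalConj τ f) ≠ 0 := by
  intro h
  apply hf
  have h1 : schwartzGalConj τ f = 0 := (LinearEquiv.map_eq_zero_iff _).1 h
  exact schwartzGalConj_injective τ (h1.trans (map_zero (schwartzGalConj (X := ι → K) τ)).symm)

end Box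

end Literature.RepresentationTheory.HeisenbergGroup

/-! ## §2 Descent of a box-compatible transport identity through `undoubleLoc` -/

namespace Literature.NumberTheory.GelbartRogawski1991.UnitaryDualPair.LocalSplitting

variable (F : Type) [Field F] [NumberField F] (E : Type) [Field E] [NumberField E] [Algebra F E] (c : E ≃ₐ[F] E)
  (v : HeightOneSpectrum (𝓞 F)) (n : ℕ)
  {T₀ : Matrix (Fin n) (Fin n) F} {J₀ : Matrix (Fin n) (Fin n) E} (hJ₀ : J₀ = T₀.map (algebraMap F E))
  {JD₀ : Matrix (Fin (n + n)) (Fin (n + n)) E} (hJD₀ : JD₀ = (gramD F n T₀).map (algebraMap F E))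
  {T₁ : Matrix (Fin n) (Fin n) F} {J₁ : Matrix (Fin n) (Fin n) E} (hJ₁ : J₁ = T₁.map (algebraMap F E))
  {JD₁ : Matrix (Fin (n + n)) (Fin (n + n)) E} (hJD₁ : JD₁ = (gramD F n T₁).map (algebraMap F E))
  [Algebra.IsQuadraticExtension F E] {δ : E} (hcδ : c δ = -δ) (hδ : δ ≠ 0) {d : F} (hd : δ * δ = algebraMap F E d)
  (hT₀ : T₀.IsSymm) (hT₀d : IsUnit T₀.det) (hT₁ : T₁.IsSymm) (hT₁d : IsUnit T₁.det)
  (s₀ : UnitaryGroup.localPi E c (n + n) JD₀ v →* LocalMp F (n + n) (gramD F n T₀) v)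
  (hs₀ : ∀ g, MpPsi.proj _ (s₀ g) = iota F E c (n + n) hcδ hδ hd (gramD F n T₀) (gramD_isSymm F n hT₀) hJD₀ v g)
  (s₁ : UnitaryGroup.localPi E c (n + n) JD₁ v →* LocalMp F (n + n) (gramD F n T₁) v)
  (hs₁ : ∀ g, MpPsi.proj _ (s₁ g) = iota F E c (n + n) hcδ hδ hd (gramD F n T₁) (gramD_isSymm F n hT₁) hJD₁ v g)

set_option maxHeartbeats 400000 in
/-- **DESCENT THROUGH UNDOUBLING.**  Two doubled packages `(T₀, s₀^𝔻)`, `(T₁, s₁^𝔻)` (homomorphisms of `U(Tᵢ ⊕ −Tᵢ)(F_v)` into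
`S̃p(𝕎^𝔻_v)` over `ι^𝔻_v`), maps `B` of `𝒮(F_vⁿ)` and `BD` of `𝒮(F_v^{n+n})` box-compatible on one pair of test vectors
(`BD (f₁ ⊠ f₂) = B f₁ ⊠ f₂'` for all `f₁`, with `f₂' ≠ 0`), and elements `g ∈ U(T₀)(F_v)`, `g' ∈ U(T₁)(F_v)`: if the DOUBLED operators
satisfy `BD (ω^𝔻₀(s₀^𝔻(g ⊕ 1)) (f₁ ⊠ f₂)) = ω^𝔻₁(s₁^𝔻(g' ⊕ 1)) (BD (f₁ ⊠ f₂))` for all `f₁`, then the UNDOUBLED operators satisfy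
`B (ω₀(undoubleLoc s₀^𝔻 g) f₁) = ω₁(undoubleLoc s₁^𝔻 g') (B f₁)` — strip `⊠ f₂` on both sides (`toRep_undoubleLoc_boxSB`) and cancel
`⊠ f₂'`. [cite: MoeglinVignerasWaldspurger1987, Chap. 2 II.1 Rem. (6)] [cite: GelbartRogawski1991, §3.1 Prop. 3.1.1 p. 455 L1–3] -/
theorem apply_toRep_undoubleLoc_eq_of_box_transport
    (B : SchwartzBruhat (Fin n → v.adicCompletion F) → SchwartzBruhat (Fin n → v.adicCompletion F))
    (BD : SchwartzBruhat (Fin (n + n) → v.adicCompletion F) → SchwartzBruhat (Fin (n + n) → v.adicCompletion F))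
    (f₂ f₂' : SchwartzBruhat (Fin n → v.adicCompletion F)) (hf₂' : f₂' ≠ 0)
    (hbox : ∀ f₁ : SchwartzBruhat (Fin n → v.adicCompletion F),
      BD (boxSB (v.adicCompletion F) (e₂ n) f₁ f₂) = boxSB (v.adicCompletion F) (e₂ n) (B f₁) f₂')
    (g : UnitaryGroup.localPi E c n J₀ v) (g' : UnitaryGroup.localPi E c n J₁ v)
    (hT : ∀ f₁ : SchwartzBruhat (Fin n → v.adicCompletion F),
      BD (MpPsi.toRep (localSchrodinger F (n + n) (gramD F n T₀) v) (s₀ (inlLoc F E c v n hJ₀ hJD₀ g))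
          (boxSB (v.adicCompletion F) (e₂ n) f₁ f₂)) =
        MpPsi.toRep (localSchrodinger F (n + n) (gramD F n T₁) v) (s₁ (inlLoc F E c v n hJ₁ hJD₁ g'))
          (BD (boxSB (v.adicCompletion F) (e₂ n) f₁ f₂)))
    (f₁ : SchwartzBruhat (Fin n → v.adicCompletion F)) :
    B (MpPsi.toRep (localSchrodinger F n T₀ v) (undoubleLoc F E c v n hJ₀ hJD₀ hcδ hδ hd hT₀ hT₀d s₀ hs₀ g) f₁) =
      MpPsi.toRep (localSchrodinger F n T₁ v) (undoubleLoc F E c v n hJ₁ hJD₁ hcδ hδ hd hT₁ hT₁d s₁ hs₁ g') (B f₁) := by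
  refine boxSB_left_cancel (v.adicCompletion F) (e₂ n) hf₂' ?_
  rw [← hbox, ← toRep_undoubleLoc_boxSB F E c v n hJ₀ hJD₀ hcδ hδ hd hT₀ hT₀d s₀ hs₀ g f₁ f₂, hT f₁, hbox,
    toRep_undoubleLoc_boxSB F E c v n hJ₁ hJD₁ hcδ hδ hd hT₁ hT₁d s₁ hs₁ g' (B f₁) f₂']

/-- **the same for the Galois-twist road's transport `B = D_s ∘ (τ ∘ ·)`** (box-compatible on the nose, `galDilation_boxSB`, and
injective, `galDilation_ne_zero`): a doubled identity `(D_s ∘ τ∘)(ω^𝔻₀(s₀^𝔻(g ⊕ 1)) F) = ω^𝔻₁(s₁^𝔻(g' ⊕ 1))((D_s ∘ τ∘) F)` on products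
`F = f₁ ⊠ f₂` (one `f₂ ≠ 0`) descends to `(D_s ∘ τ∘)(ω₀(undoubleLoc s₀^𝔻 g) f₁) = ω₁(undoubleLoc s₁^𝔻 g')((D_s ∘ τ∘) f₁)`.
[cite: MoeglinVignerasWaldspurger1987, Chap. 2 II.1 (transport of structure) and Rem. (6)] [cite: Liu2021, Thm. 4.18 (3), proof l. 2272–2289] -/
theorem galDilation_toRep_undoubleLoc_eq_of_transport (τ : ℂ →+* ℂ) (t : (v.adicCompletion F)ˣ)
    {f₂ : SchwartzBruhat (Fin n → v.adicCompletion F)} (hf₂ : f₂ ≠ 0)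
    (g : UnitaryGroup.localPi E c n J₀ v) (g' : UnitaryGroup.localPi E c n J₁ v)
    (hT : ∀ f₁ : SchwartzBruhat (Fin n → v.adicCompletion F),
      leviEquivSB (LinearEquiv.smulOfUnit t : (Fin (n + n) → v.adicCompletion F) ≃ₗ[v.adicCompletion F]
            (Fin (n + n) → v.adicCompletion F)) (continuous_const_smul (t : v.adicCompletion F))
          (continuous_const_smul ((t⁻¹ : (v.adicCompletion F)ˣ) : v.adicCompletion F))
          (schwartzGalConj τ (MpPsi.toRep (localSchrodinger F (n + n) (gramD F n T₀) v) (s₀ (inlLoc F E c v n hJ₀ hJD₀ g))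
            (boxSB (v.adicCompletion F) (e₂ n) f₁ f₂))) =
        MpPsi.toRep (localSchrodinger F (n + n) (gramD F n T₁) v) (s₁ (inlLoc F E c v n hJ₁ hJD₁ g'))
          (leviEquivSB (LinearEquiv.smulOfUnit t : (Fin (n + n) → v.adicCompletion F) ≃ₗ[v.adicCompletion F]
              (Fin (n + n) → v.adicCompletion F)) (continuous_const_smul (t : v.adicCompletion F))
            (continuous_const_smul ((t⁻¹ : (v.adicCompletion F)ˣ) : v.adicCompletion F))
            (schwartzGalConj τ (boxSB (v.adicCompletion F) (e₂ n) f₁ f₂))))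
    (f₁ : SchwartzBruhat (Fin n → v.adicCompletion F)) :
    leviEquivSB (LinearEquiv.smulOfUnit t : (Fin n → v.adicCompletion F) ≃ₗ[v.adicCompletion F] (Fin n → v.adicCompletion F))
        (continuous_const_smul (t : v.adicCompletion F))
        (continuous_const_smul ((t⁻¹ : (v.adicCompletion F)ˣ) : v.adicCompletion F))
        (schwartzGalConj τ (MpPsi.toRep (localSchrodinger F n T₀ v)
          (undoubleLoc F E c v n hJ₀ hJD₀ hcδ hδ hd hT₀ hT₀d s₀ hs₀ g) f₁)) =
      MpPsi.toRep (localSchrodinger F n T₁ v) (undoubleLoc F E c v n hJ₁ hJD₁ hcδ hδ hd hT₁ hT₁d s₁ hs₁ g')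
        (leviEquivSB (LinearEquiv.smulOfUnit t : (Fin n → v.adicCompletion F) ≃ₗ[v.adicCompletion F]
            (Fin n → v.adicCompletion F)) (continuous_const_smul (t : v.adicCompletion F))
          (continuous_const_smul ((t⁻¹ : (v.adicCompletion F)ˣ) : v.adicCompletion F)) (schwartzGalConj τ f₁)) :=
  apply_toRep_undoubleLoc_eq_of_box_transport F E c v n hJ₀ hJD₀ hJ₁ hJD₁ hcδ hδ hd hT₀ hT₀d hT₁ hT₁d s₀ hs₀ s₁ hs₁
    (fun f => leviEquivSB (LinearEquiv.smulOfUnit t : (Fin n → v.adicCompletion F) ≃ₗ[v.adicCompletion F]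
        (Fin n → v.adicCompletion F)) (continuous_const_smul (t : v.adicCompletion F))
      (continuous_const_smul ((t⁻¹ : (v.adicCompletion F)ˣ) : v.adicCompletion F)) (schwartzGalConj τ f))
    (fun f => leviEquivSB (LinearEquiv.smulOfUnit t : (Fin (n + n) → v.adicCompletion F) ≃ₗ[v.adicCompletion F]
        (Fin (n + n) → v.adicCompletion F)) (continuous_const_smul (t : v.adicCompletion F))
      (continuous_const_smul ((t⁻¹ : (v.adicCompletion F)ˣ) : v.adicCompletion F)) (schwartzGalConj τ f))
    f₂ _ (galDilation_ne_zero (v.adicCompletion F) τ t hf₂)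
    (fun f => galDilation_boxSB (v.adicCompletion F) (e := e₂ n) τ t f f₂) g g' hT f₁

end Literature.NumberTheory.GelbartRogawski1991.UnitaryDualPair.LocalSplitting

end
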